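import Literature.Computability.Complexity.AlgebrizationBarriers
import Literature.Computability.Complexity.MultilinearExtension
import Literature.Computability.Complexity.OracleBPP
import Literature.Computability.Complexity.StringEquality
import Literature.Computability.Complexity.PairPlumbing
import HarnessLib

/-!
# Discharge of `aaronsonWigderson2009_bqp_subset_bpp_collapse` (the algebraic collapse `BQP^Ã ⊆ BPP^A`)

Sibling proof file of `AlgebrizationBarriers.lean` (D-0014). It proves, unconditionally and in
the tree's models (`BQPRel`: polynomial-time uniform Clifford+T circuit families with XOR query
gates, `ClassBQP.lean`; `BPPRel O = bp (P^O)` in the transcript model of `Oracle.lean`;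
extension oracles `ExtensionOracle.toOracle` over the prime fields, `Algebrization.lean`), the
named fact

* `aaronsonWigderson2009_bqp_subset_bpp_collapse_holds`: there are an oracle language `A` and a
  multilinear extension `Ã` of `A` (`Ã.IsExtensionOf A 1`) with `BQP^Ã ⊆ BPP^A`, quantum access
  to `Ã` being through its bit language `Oracle.bitLanguage Ã.toOracle`

— the `BQP` instance of the collapse direction of Aaronson–Wigderson's algebrization barrier
(S. Aaronson, A. Wigderson, *Algebrization: a new barrier in complexity theory*, STOC 2008 /
ACM TOCT 1 (2009), Thm. 5.2 p. 23 with Def. 2.3 p. 9: "proving `C ⊄ D` requires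
non-algebrizing techniques if there exist `A, Ã` such that `C^Ã ⊆ D^A`").

## The proof (a different witness than the printed one)

Aaronson–Wigderson take `A` `PSPACE`-complete and `Ã` its multilinear extension, which is again
`PSPACE`-computable (Babai–Fortnow–Lund), so that `C^Ã ⊆ PSPACE^{Ã[poly]} = PSPACE = P^A`
(Thm. 5.1/5.2, p. 23). The tree has no relativised `PSPACE` and no `PSPACE`-completeness yet, so
this file proves the (existential) fact with another witness, the folklore **autoreducible
oracle** built in stages by string length (the direct alternative to a complete language in
Baker–Gill–Solovay-style collapses such as `P^A = NP^A`, here run against quantum circuits with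
access to the multilinear extension of the oracle): `A` consists of the codes `⟨x, ⌜n, m, C⌝⟩` (`boolPair x (QCircuit.sigmaEncode ⟨n, m, C⟩)`,
`n = |x|`) of a Clifford+T circuit `C` on `n + m` wires together with an input `x` such that `C`,
run on `|x⟩|0^m⟩` with its oracle gates answered by the bit language of the multilinear
extension `Ã` of `A` itself, accepts with probability `≥ 1/2` (`AWCollapse.oracle`,
`AWCollapse.mem_oracle_iff`). This is well defined because

* an oracle gate of a circuit on `N` wires queries strings of length `< N`
  (`AWCollapse.circuitMatrix_congr`, `acceptProb_congr`: the semantics of a circuit on `N` wires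
  depends on the oracle language below length `N` only);
* a string of length `< N` of the bit language of `Ã.toOracle` concerns a query `q` with
  `|q| < N`, hence an arity `≤ |q|` (`arity_le_length_of_decode`), and the arity-`n` polynomial
  of the multilinear extension depends on `A ∩ {0,1}ⁿ` only (`multilinearExtension_poly_congr`)
  — so below length `N` the bit language of `Ã` depends on `A` below length `N`
  (`AWCollapse.mem_bitLanguage_multilinearExtension_congr`);
* the code `⟨x, ⌜n, m, C⌝⟩` is longer than `N = n + m` (the ancilla count `m` is written in
  unary in `sigmaEncode`, and `x` has length `n`).

Then for `L ∈ BQP^Ã`, decided by the uniform family `F` with error `≤ 1/3`, the map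
`x ↦ ⟨x, ⌜|x|, F.ancillas |x|, F.circ |x|⌝⟩` is polynomial-time (uniformity of `F` composed with
`x ↦ 1^{|x|}`, `onesFn_mem_FP`, `PolyTimeComputable.comp_holds`, `fanoutFn_mem_FP`) and is a Karp
reduction of `L` to `A` (`2/3 ≥ 1/2 > 1/3`); Karp reductions are Cook reductions
(`PolyTimeKarpReducible.turing_holds`), so `L ∈ P^A ⊆ BPP^A` (`PRel_subset_BPPRel_holds`).

## References

* S. Aaronson, A. Wigderson, *Algebrization: a new barrier in complexity theory*, STOC 2008, full
  version: Def. 2.2–2.3 (pp. 8–9), Thm. 5.1–5.2 (p. 23), §4.1 (multilinear extensions)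
  [AaronsonWigderson2008]; journal version ACM TOCT 1 (2009) [AaronsonWigderson2009].
* T. Baker, J. Gill, R. Solovay, *Relativizations of the P =? NP question*, SIAM J. Comput. 4
  (1975), §1–2 (oracles built in stages by length; an oracle with `P^A = NP^A`)
  [BakerGillSolovay1975].
* E. Bernstein, U. Vazirani, *Quantum complexity theory*, SIAM J. Comput. 26 (1997), §8 (oracle
  quantum machines) [BernsteinVazirani1997].
-/

noncomputable section

namespace Literature.Computability.Complexity

open _root_.Computability Cryptography

namespace AWCollapse

/-! ### Locality of oracle circuits: a circuit on `N` wires reads the oracle below length `N` -/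

section Circuits

variable {G : QGateSet} {N : ℕ}

/-- Two oracle languages agreeing on the strings of length `k` have the same XOR query gate on
`k` query wires. [folklore] -/
theorem oracleGate_congr {A B : Language Bool} {k : ℕ}
    (h : ∀ w : List Bool, w.length = k → (w ∈ A ↔ w ∈ B)) : oracleGate A k = oracleGate B k := by
  have hind : ∀ w : List Bool, w.length = k → A.boolIndicator w = B.boolIndicator w := by
    intro w hw
    by_cases hB : w ∈ B
    · rw [(Set.mem_iff_boolIndicator _ _).1 hB, (Set.mem_iff_boolIndicator _ _).1 ((h w hw).2 hB)]
    · rw [(Set.notMem_iff_boolIndicator _ _).1 hB,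
        (Set.notMem_iff_boolIndicator _ _).1 fun hA => hB ((h w hw).1 hA)]
  unfold oracleGate
  congr 1
  funext x y
  rw [hind _ (List.length_ofFn)]

/-- The matrix of a placed gate on `N` wires depends on the oracle language below length `N`
only (an oracle gate with `k` query wires embeds `k + 1 ≤ N` wires). [folklore] -/
theorem gateMatrix_congr {A B : Language Bool}
    (h : ∀ w : List Bool, w.length < N → (w ∈ A ↔ w ∈ B)) (g : QGate G N) :
    g.toMatrix A = g.toMatrix B := by
  cases g with
  | gate g e => rfl
  | oracle k e =>
    have hk : k + 1 ≤ N := by simpa using Fintype.card_le_of_embedding e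
    simp only [QGate.toMatrix_oracle]
    rw [oracleGate_congr fun w hw => h w (by omega)]

/-- **Locality of oracle circuits**: the matrix of a circuit on `N` wires depends on the oracle
language below length `N` only. [folklore] -/
theorem circuitMatrix_congr {A B : Language Bool}
    (h : ∀ w : List Bool, w.length < N → (w ∈ A ↔ w ∈ B)) (C : QCircuit G N) :
    C.toMatrix A = C.toMatrix B := by
  obtain ⟨gs⟩ := C
  induction gs with
  | nil => simp
  | cons g gs ih => rw [QCircuit.toMatrix_cons, QCircuit.toMatrix_cons, ih, gateMatrix_congr h g]

/-- Acceptance probabilities of a circuit on `n + m` wires depend on the oracle language below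
length `n + m` only. [folklore] -/
theorem acceptProb_congr {n m : ℕ} {A B : Language Bool}
    (h : ∀ w : List Bool, w.length < n + m → (w ∈ A ↔ w ∈ B)) (C : QCircuit G (n + m))
    (x : QReg n) : C.acceptProb A x = C.acceptProb B x := by
  unfold QCircuit.acceptProb QCircuit.runOn
  rw [circuitMatrix_congr h C]

end Circuits

/-! ### Locality of the bit language of the multilinear extension -/

/-- Two function oracles agreeing on the queries shorter than `y` agree on whether `y` belongs to
their bit languages (a bit-language string `⟨q, tag :: bin i⟩` is longer than its query `q`).
[cite: AaronsonWigderson2009, Def. 2.3] -/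
theorem mem_bitLanguage_congr {O O' : Oracle} {y : List Bool}
    (h : ∀ q : List Bool, q.length < y.length → O q = O' q) :
    y ∈ Oracle.bitLanguage O ↔ y ∈ Oracle.bitLanguage O' := by
  have key : ∀ (q t : List Bool), y = boolPair q t → O q = O' q := by
    intro q t hy
    refine h q ?_
    rw [hy, length_boolPair]
    omega
  change (∃ (q : List Bool) (i : ℕ), _) ↔ (∃ (q : List Bool) (i : ℕ), _)
  constructor
  · rintro ⟨q, i, (⟨hy, hb⟩ | ⟨hy, hb⟩)⟩
    · exact ⟨q, i, Or.inl ⟨hy, by rwa [← key q _ hy]⟩⟩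
    · exact ⟨q, i, Or.inr ⟨hy, by rwa [← key q _ hy]⟩⟩
  · rintro ⟨q, i, (⟨hy, hb⟩ | ⟨hy, hb⟩)⟩
    · exact ⟨q, i, Or.inl ⟨hy, by rwa [key q _ hy]⟩⟩
    · exact ⟨q, i, Or.inr ⟨hy, by rwa [key q _ hy]⟩⟩

/-- **Below length `N`, the bit language of the multilinear extension of `S` depends on `S` below
length `N` only**: a query `q` of length `< N` concerns an arity `n ≤ |q|`
(`arity_le_length_of_decode`), at which the multilinear extension is determined by `S ∩ {0,1}ⁿ`.
[cite: AaronsonWigderson2008, §4.1 and Def. 2.2] -/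
theorem mem_bitLanguage_multilinearExtension_congr {S S' : Language Bool} {N : ℕ}
    (h : ∀ w : List Bool, w.length < N → (w ∈ S ↔ w ∈ S')) {y : List Bool} (hy : y.length < N) :
    y ∈ Oracle.bitLanguage (multilinearExtension S).toOracle ↔
      y ∈ Oracle.bitLanguage (multilinearExtension S').toOracle := by
  refine mem_bitLanguage_congr fun q hq => ?_
  refine ExtensionOracle.toOracle_congr_of_length (ℓ := q.length) (fun p n hn => ?_) le_rfl
  exact multilinearExtension_poly_congr (sliceFn_congr fun w hw => h w (by omega)) p

/-! ### The autoreducible oracle -/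

/-- `Accepts S w`: `w` is the code `⟨x, ⌜|x|, m, C⌝⟩` of a Clifford+T circuit `C` on `|x| + m`
wires and an input `x`, and `C` run on `|x⟩|0^m⟩`, with its oracle gates answered by the bit
language of the multilinear extension of `S`, accepts (wire `0`) with probability `≥ 1/2`.
[folklore] -/
def Accepts (S : Language Bool) (w : List Bool) : Prop :=
  ∃ (x : List Bool) (m : ℕ) (C : QCircuit cliffordT (x.length + m)),
    w = boolPair x (QCircuit.sigmaEncode ⟨x.length, m, C⟩) ∧
      (1 / 2 : ℝ) ≤ C.acceptProb (Oracle.bitLanguage (multilinearExtension S).toOracle) x.get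

/-- A code `⟨x, ⌜|x|, m, C⌝⟩` is longer than the number `|x| + m` of wires of its circuit (the
ancilla count is unary in `sigmaEncode`). [folklore] -/
theorem lt_length_code (x : List Bool) (m : ℕ) (C : QCircuit cliffordT (x.length + m)) :
    x.length + m < (boolPair x (QCircuit.sigmaEncode ⟨x.length, m, C⟩)).length := by
  have hm : (unaryEncodeNat m).length = m := unary_decode_encode_nat m
  simp only [QCircuit.sigmaEncode, length_boolPair, hm]
  omega

/-- **Locality of acceptance**: `Accepts S w` depends on `S` below length `|w|` only. [folklore] -/
theorem accepts_congr {S S' : Language Bool} {w : List Bool}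
    (h : ∀ v : List Bool, v.length < w.length → (v ∈ S ↔ v ∈ S')) : Accepts S w ↔ Accepts S' w := by
  unfold Accepts
  refine exists_congr fun x => exists_congr fun m => exists_congr fun C =>
    and_congr_right fun hw => ?_
  have hlen : x.length + m < w.length := hw ▸ lt_length_code x m C
  rw [acceptProb_congr (fun v hv => mem_bitLanguage_multilinearExtension_congr (N := x.length + m)
    (fun u hu => h u (hu.trans hlen)) hv) C x.get]

/-- Stage `ℓ` of the construction: the oracle restricted to the strings of length `< ℓ`
(strings of length `ℓ` are decided at stage `ℓ + 1` against stage `ℓ`). [cite: BakerGillSolovay1975, §2 (construction in stages)] -/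
def stage : ℕ → Language Bool
  | 0 => {_w | False}
  | ℓ + 1 => {w | w ∈ stage ℓ ∨ (w.length = ℓ ∧ Accepts (stage ℓ) w)}

/-- **The collapse oracle** `A` (autoreducible oracle, built in stages by length): a string
belongs to `A` iff it is put in at the stage after its length. [folklore] -/
def oracle : Language Bool :=
  {w | w ∈ stage (w.length + 1)}

/-- Stage `ℓ` only contains strings of length `< ℓ`. [folklore] -/
theorem length_lt_of_mem_stage : ∀ {ℓ : ℕ} {w : List Bool}, w ∈ stage ℓ → w.length < ℓ
  | 0, _, h => False.elim h
  | ℓ + 1, _, h => by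
    rcases h with h | ⟨h, -⟩
    · exact (length_lt_of_mem_stage h).trans (Nat.lt_succ_self ℓ)
    · omega

/-- Later stages do not change the strings already decided. [folklore] -/
theorem mem_stage_succ_iff_of_lt {ℓ : ℕ} {w : List Bool} (hw : w.length < ℓ) :
    w ∈ stage (ℓ + 1) ↔ w ∈ stage ℓ := by
  change (w ∈ stage ℓ ∨ (w.length = ℓ ∧ Accepts (stage ℓ) w)) ↔ _
  constructor
  · rintro (h | ⟨h, -⟩)
    · exact h
    · omega
  · exact Or.inl

/-- Below length `ℓ`, stage `ℓ` agrees with the oracle. [folklore] -/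
theorem mem_stage_iff_of_lt {ℓ : ℕ} {w : List Bool} (hw : w.length < ℓ) :
    w ∈ stage ℓ ↔ w ∈ oracle := by
  change _ ↔ w ∈ stage (w.length + 1)
  obtain ⟨d, rfl⟩ := Nat.exists_eq_add_of_lt hw
  induction d with
  | zero => rfl
  | succ d ih =>
    rw [show w.length + (d + 1) + 1 = (w.length + d + 1) + 1 by omega,
      mem_stage_succ_iff_of_lt (by omega)]
    exact ih (by omega)

/-- **The oracle is autoreducible for quantum circuits with access to its multilinear
extension**: `⟨x, ⌜|x|, m, C⌝⟩ ∈ A` iff `C`, with oracle gates answered by the bit language of the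
multilinear extension of `A`, accepts `x` with probability `≥ 1/2`. [folklore] -/
theorem mem_oracle_iff (w : List Bool) : w ∈ oracle ↔ Accepts oracle w := by
  change (w ∈ stage w.length ∨ (w.length = w.length ∧ Accepts (stage w.length) w)) ↔ _
  have h1 : w ∉ stage w.length := fun h => lt_irrefl _ (length_lt_of_mem_stage h)
  rw [accepts_congr (S := stage w.length) (S' := oracle) fun v hv => mem_stage_iff_of_lt hv]
  tauto

/-! ### The reduction -/

/-- The code map of a circuit family `F`: `x ↦ ⟨x, ⌜|x|, F.ancillas |x|, F.circ |x|⌝⟩`. [folklore] -/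
def code (F : QCircuitFamily cliffordT) (x : List Bool) : List Bool :=
  boolPair x (QCircuit.sigmaEncode ⟨x.length, F.ancillas x.length, F.circ x.length⟩)

/-- The code of `x` is accepted iff the circuit `F.circ |x|` accepts `x` with probability
`≥ 1/2` (injectivity of `boolPair` and `sigmaEncode`). [folklore] -/
theorem accepts_code_iff (S : Language Bool) (F : QCircuitFamily cliffordT) (x : List Bool) :
    Accepts S (code F x) ↔
      (1 / 2 : ℝ) ≤ (F.circ x.length).acceptProb
        (Oracle.bitLanguage (multilinearExtension S).toOracle) x.get := by
  constructor
  · rintro ⟨x', m, C, hw, hacc⟩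
    obtain ⟨hx, hσ⟩ := QCircuit.boolPair_inj hw
    subst hx
    have h1 := QCircuit.sigmaEncode_injective hσ
    rw [Sigma.mk.inj_iff] at h1
    have h2 := eq_of_heq h1.2
    rw [Sigma.mk.inj_iff] at h2
    obtain ⟨hm, hC⟩ := h2
    subst hm
    have hC' := eq_of_heq hC
    subst hC'
    exact hacc
  · exact fun h => ⟨x, _, _, rfl, h⟩

/-- **The code map of a uniform family is polynomial-time**: uniformity gives
`1ⁿ ↦ ⌜n, F.ancillas n, F.circ n⌝` in polynomial time; precompose with `x ↦ 1^{|x|}` and pair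
with `x`. [folklore] -/
theorem code_mem_FP {F : QCircuitFamily cliffordT} (hU : F.IsUniform) : code F ∈ FP := by
  have h1 : PolyTimeComputable (id : List Bool → List Bool) unaryEncodeNat List.length :=
    onesFn_mem_FP
  have h2 : PolyTimeComputable (id : List Bool → List Bool) (QCircuit.sigmaEncode (G := cliffordT))
      ((fun n => (⟨n, F.ancillas n, F.circ n⟩ : Σ n m : ℕ, QCircuit cliffordT (n + m))) ∘
        List.length) :=
    PolyTimeComputable.comp_holds hU h1
  have h3 : (fun w : List Bool =>
      QCircuit.sigmaEncode (⟨w.length, F.ancillas w.length, F.circ w.length⟩ :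
        Σ n m : ℕ, QCircuit cliffordT (n + m))) ∈ FP := h2
  have h4 := fanoutFn_mem_FP (PolyTimeComputable.id (id : List Bool → List Bool)) h3
  have hcode : code F = fanoutFn id fun w : List Bool =>
      QCircuit.sigmaEncode (⟨w.length, F.ancillas w.length, F.circ w.length⟩ :
        Σ n m : ℕ, QCircuit cliffordT (n + m)) := by
    funext w
    rw [fanoutFn_apply]
    rfl
  rw [hcode]
  exact h4

/-- Every language of `BQP^Ã` (`Ã` the multilinear extension of the oracle, accessed through its
bit language) Karp-reduces to the oracle, by the code map of a deciding family. [folklore] -/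
theorem karpReducible_oracle {L : Language Bool}
    (hL : L ∈ BQPRel (Oracle.bitLanguage (multilinearExtension oracle).toOracle)) :
    PolyTimeKarpReducible L oracle := by
  obtain ⟨F, hU, hdec⟩ := hL
  refine ⟨code F, code_mem_FP hU, fun x => ?_⟩
  change x ∈ L ↔ code F x ∈ oracle
  rw [mem_oracle_iff, accepts_code_iff]
  constructor
  · intro hx
    have h := (hdec x).1 hx
    change 2 / 3 ≤ (F.circ x.length).acceptProb _ x.get at h
    linarith
  · intro h
    by_contra hx
    have h' := (hdec x).2 hx
    change (F.circ x.length).acceptProb _ x.get ≤ 1 / 3 at h'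
    linarith

end AWCollapse

/-- **Discharge of `aaronsonWigderson2009_bqp_subset_bpp_collapse`** (Aaronson–Wigderson, the
`BQP` instance of the Thm. 5.2 collapse): there are an oracle language `A` and a multilinear
extension `Ã` of `A` with `BQP^Ã ⊆ BPP^A` — witnessed by the autoreducible oracle
`AWCollapse.oracle` and its multilinear extension: `BQP^Ã ⊆ P^A` by the Karp reduction
`AWCollapse.karpReducible_oracle` (Karp ⇒ Cook, `PolyTimeKarpReducible.turing_holds`), and
`P^A ⊆ BPP^A` (`PRel_subset_BPPRel_holds`). [cite: AaronsonWigderson2008, Thm. 5.2 and Def. 2.3] -/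
theorem aaronsonWigderson2009_bqp_subset_bpp_collapse_holds :
    aaronsonWigderson2009_bqp_subset_bpp_collapse :=
  ⟨AWCollapse.oracle, multilinearExtension AWCollapse.oracle, multilinearExtension_isExtensionOf _,
    fun _ hL => PRel_subset_BPPRel_holds _
      (PolyTimeKarpReducible.turing_holds (AWCollapse.karpReducible_oracle hL))⟩

end Literature.Computability.Complexity

end
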